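import Mathlib
import Summits.ValiantsHypothesis.ValiantsHypothesis.Theses.ElementaryWordLength
import Summits.ValiantsHypothesis.ValiantsHypothesis.Theorems.ElementaryWordLengthWordPerSuperQuarticStubWordSubst
import Summits.ValiantsHypothesis.ValiantsHypothesis.Theorems.ElementaryWordLengthWordPerSuperQuarticStubChainNormalForm
import Summits.ValiantsHypothesis.ValiantsHypothesis.Theorems.ElementaryWordLengthWordPerSuperQuarticOfBlockHardness
import Summits.ValiantsHypothesis.ValiantsHypothesis.Theorems.ElementaryWordLengthWordPerSuperQuarticStubPatternCount

/-!
# Crux `ElementaryWordLength.WordPerSuperQuartic` (stmt-ValiantsHypothesis-6624), line `Sketch`: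
# **pattern chain hardness ⇒ the crux** (the reshaped glue of cycle 5)

Line `Sketch` (`Cruxes/WordPerSuperQuartic/Lines/Sketch.lean`) reduces the crux — every affine elementary
word for `E_02(per_n)` has length `≥ n^(4+ε)` — to ONE open statement.  Up to cycle 4 that statement was
chain hardness of the DIAGONAL-TRANSVERSAL block restriction of `per_n` (`stub_chainHardness`, threshold
`2b·n^(2+ε)`; glue `wordPerSuperQuartic_of_blockHardness`, p107551).  This file proves the glue for its
weakest form, **pattern chain hardness** (S1b'): for some `ε > 0` and all large `n` there are an ARBITRARY
nonempty set `S` of variable positions and complex values `x` off `S` such that every chain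
`Π_t (1 + x_{v_t}·N_t)` of constant square-zero `3 × 3` matrices reading only `S` that equals
`E_02(P − P(0))`, `P = per_n|_{x off S}`, has more than `|S|·n^(2+ε)` factors.

* `wordPerSuperQuartic_of_patternChainHardness : S1b' → WordPerSuperQuartic` (same `ε`).  Proof: the chain
  normal form (`stub_chainNormalForm`, p108980, with the predicate `· ∈ S`) turns S1b' into its word form;
  each of the `n²` cyclic translates `S + g` is carried onto `S` by a row rotation and a column rotation
  (`per_n` is invariant: `rename_prodMap_perPoly_eq`; the word is renamed letter by letter:
  `rename_wordProd`), the off-pattern variables are frozen at `x` (`stub_wordSubst`, p104130), so the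
  `(S + g)`-letters of the word number `> |S|·n^(2+ε)`; every variable letter is an `(S + g)`-letter for
  exactly `|S|` translates (`stub_patternCount`, p116261), whence `|S|·|w| > n²·|S|·n^(2+ε)`.
* `patternChainHardness_of_chainHardness : S1b → S1b'` — the reshape is a weakening (take `S` = the
  diagonal block).

The converse `WordPerSuperQuartic → S1b'` (so that S1b' is EQUIVALENT to the crux) is
`Theorems/ElementaryWordLengthWordPerSuperQuarticPatternConverse.lean`.  What is NOT here: a proof of S1b'
— it is the crux itself in chain clothing (see `Cruxes/WordPerSuperQuartic/NOTES.md`).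
References: Ben-Or–Cleve 1992 (the word model); Nechiporuk 1966 / Kalorkoti 1985 (restriction counting).
-/

noncomputable section

-- `Summit.ValiantsHypothesis.ValiantsHypothesis.…` is the tree's mandated single-conjunct layout.
set_option linter.dupNamespace false

namespace Summit.ValiantsHypothesis.ValiantsHypothesis.Theorems.WordPerSuperQuartic

open Literature.Computability.AlgebraicComplexity MvPolynomial

/-! ## Pattern block hardness (word form) from the chain normal form -/

/-- **Pattern block hardness** (word form of S1b') from its chain form, by the chain normal form
(`stub_chainNormalForm` with the pattern predicate `· ∈ S`): the chain of a block word has exactly as many factors as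
the word has variable letters. -/
theorem patternBlockHardness_of_patternChainHardness
    (hC : ∃ ε : ℝ, 0 < ε ∧ ∃ n₀ : ℕ, ∀ n ≥ n₀, ∃ S : Finset (Fin n × Fin n), 0 < S.card ∧
      ∃ x : Fin n × Fin n → ℂ, ∀ L : List ((Fin n × Fin n) × Matrix (Fin 3) (Fin 3) ℂ),
        (∀ e ∈ L, e.1 ∈ S) →
        (∀ e ∈ L, e.2 * e.2 = 0) →
        (L.map (fun e => (1 : Matrix (Fin 3) (Fin 3) (MvPolynomial (Fin n × Fin n) ℂ)) +
            (MvPolynomial.X e.1 : MvPolynomial (Fin n × Fin n) ℂ) •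
              e.2.map (MvPolynomial.C : ℂ → MvPolynomial (Fin n × Fin n) ℂ))).prod =
          Matrix.transvection (0 : Fin 3) 2
            (MvPolynomial.aeval (fun v : Fin n × Fin n =>
                if v ∈ S then MvPolynomial.X v else MvPolynomial.C (x v)) (perPoly (Fin n) ℂ) -
              MvPolynomial.C (MvPolynomial.constantCoeff (MvPolynomial.aeval (fun v : Fin n × Fin n =>
                if v ∈ S then MvPolynomial.X v else MvPolynomial.C (x v)) (perPoly (Fin n) ℂ)))) →
        (S.card : ℝ) * (n : ℝ) ^ (2 + ε) < (L.length : ℝ)) :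
    ∃ ε : ℝ, 0 < ε ∧ ∃ n₀ : ℕ, ∀ n ≥ n₀, ∃ S : Finset (Fin n × Fin n), 0 < S.card ∧
      ∃ x : Fin n × Fin n → ℂ, ∀ w : List (Fin 3 × Fin 3 × ℂ × Option (Fin n × Fin n)),
        (∀ l ∈ w, l.1 ≠ l.2.1) →
        (∀ l ∈ w, ∀ v, l.2.2.2 = some v → v ∈ S) →
        (w.map (fun l => Matrix.transvection l.1 l.2.1
            (C l.2.2.1 * l.2.2.2.elim 1 X))).prod =
          Matrix.transvection (0 : Fin 3) 2
            (aeval (fun v : Fin n × Fin n => if v ∈ S then X v else C (x v)) (perPoly (Fin n) ℂ)) →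
        (S.card : ℝ) * (n : ℝ) ^ (2 + ε) < (w.countP (fun l => l.2.2.2.isSome) : ℝ) := by
  obtain ⟨ε, hε, n₀, hC⟩ := hC
  refine ⟨ε, hε, n₀, fun n hn => ?_⟩
  obtain ⟨S, hS, x, hx⟩ := hC n hn
  refine ⟨S, hS, x, fun w hw hv hprod => ?_⟩
  obtain ⟨L, hlen, hp, hN, hchain⟩ :=
    stub_chainNormalForm (fun v : Fin n × Fin n => v ∈ S) _ w hw hv hprod
  have h := hx L hp hN hchain
  rw [hlen] at h
  exact h


/-! ## Pattern chain hardness implies the crux -/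

/-- **Pattern block hardness (word form) ⇒ `WordPerSuperQuartic`** (line `Sketch`, the glue, same `ε`):
each of the `n²` cyclic translates `S + g` of the hard pattern is moved onto `S` by a row rotation and a
column rotation (`per_n` is invariant, the word is renamed letter by letter), the off-pattern variables
are frozen at the hard point `x` (`stub_wordSubst`), so the `(S + g)`-letters of `w` number more than
`|S|·n^(2+ε)` (`patternBlockHardness_of_patternChainHardness`); every variable letter is an `(S + g)`-letter for exactly `|S|`
translates (`stub_patternCount`), so `|S|·|w| > n²·|S|·n^(2+ε)`, i.e. `|w| > n^(4+ε)`. [folklore] -/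
theorem wordPerSuperQuartic_of_patternBlockHardness
    (hB : ∃ ε : ℝ, 0 < ε ∧ ∃ n₀ : ℕ, ∀ n ≥ n₀, ∃ S : Finset (Fin n × Fin n), 0 < S.card ∧
      ∃ x : Fin n × Fin n → ℂ, ∀ w : List (Fin 3 × Fin 3 × ℂ × Option (Fin n × Fin n)),
        (∀ l ∈ w, l.1 ≠ l.2.1) →
        (∀ l ∈ w, ∀ v, l.2.2.2 = some v → v ∈ S) →
        (w.map (fun l => Matrix.transvection l.1 l.2.1
            (C l.2.2.1 * l.2.2.2.elim 1 X))).prod =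
          Matrix.transvection (0 : Fin 3) 2
            (aeval (fun v : Fin n × Fin n => if v ∈ S then X v else C (x v)) (perPoly (Fin n) ℂ)) →
        (S.card : ℝ) * (n : ℝ) ^ (2 + ε) < (w.countP (fun l => l.2.2.2.isSome) : ℝ)) :
    Summit.ValiantsHypothesis.ValiantsHypothesis.Theses.ElementaryWordLength.WordPerSuperQuartic := by
  obtain ⟨ε, hε, n₀, hC⟩ := hB
  refine ⟨ε, hε, n₀, fun n hn L hex => ?_⟩
  obtain ⟨w, hlen, hw, hprod⟩ := hex
  obtain ⟨S, hS, x, hx⟩ := hC n hn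
  have hn0 : 0 < n := by
    obtain ⟨v, _⟩ := Finset.card_pos.1 hS
    exact Fin.pos v.1
  haveI : NeZero n := ⟨hn0.ne'⟩
  -- the per-translate bound
  have hblock : ∀ g : Fin n × Fin n,
      (S.card : ℝ) * (n : ℝ) ^ (2 + ε) <
        (w.countP (fun l => l.2.2.2.any (fun v => decide ((v.1 - g.1, v.2 - g.2) ∈ S))) : ℝ) := by
    intro g
    -- Step 1: rename the word by `e = (· - g.1) × (· - g.2)`.
    let ρ : Equiv.Perm (Fin n) := Equiv.subRight g.1
    let γ : Equiv.Perm (Fin n) := Equiv.subRight g.2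
    let e : Fin n × Fin n → Fin n × Fin n := Prod.map ρ γ
    let w₁ : List (Fin 3 × Fin 3 × ℂ × Option (Fin n × Fin n)) :=
      w.map (fun l => (l.1, l.2.1, l.2.2.1, l.2.2.2.map e))
    have hw₁ : ∀ l ∈ w₁, l.1 ≠ l.2.1 := by
      intro l hl
      obtain ⟨l₀, hl₀, rfl⟩ := List.mem_map.1 hl
      exact hw l₀ hl₀
    have hprod₁ : (w₁.map (fun l => Matrix.transvection l.1 l.2.1
        (C l.2.2.1 * l.2.2.2.elim 1 X))).prod =
          Matrix.transvection (0 : Fin 3) 2 (perPoly (Fin n) ℂ) := by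
      rw [rename_wordProd, hprod, mapMatrix_transvection]
      simp only [AlgHom.toRingHom_eq_coe, RingHom.coe_coe]
      rw [rename_prodMap_perPoly_eq]
    -- Step 2: freeze the off-pattern variables at `x`.
    let p : Fin n × Fin n → Prop := fun v => v ∈ S
    let w₂ : List (Fin 3 × Fin 3 × ℂ × Option (Fin n × Fin n)) :=
      w₁.map (fun l => if l.2.2.2.any (fun v => decide (p v)) then l
        else (l.1, l.2.1, l.2.2.1 * l.2.2.2.elim 1 x, none))
    have hw₂ : ∀ l ∈ w₂, l.1 ≠ l.2.1 := subst_offDiag p x w₁ hw₁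
    have hv₂ : ∀ l ∈ w₂, ∀ v, l.2.2.2 = some v → v ∈ S := subst_vars p x w₁
    have hprod₂ : (w₂.map (fun l => Matrix.transvection l.1 l.2.1
        (C l.2.2.1 * l.2.2.2.elim 1 X))).prod =
          Matrix.transvection (0 : Fin 3) 2
            (aeval (fun v : Fin n × Fin n => if v ∈ S then X v else C (x v)) (perPoly (Fin n) ℂ)) := by
      show ((w₁.map _).map _).prod = _
      rw [stub_wordSubst p x w₁, hprod₁, mapMatrix_transvection]
      rfl
    have hcount := hx w₂ hw₂ hv₂ hprod₂
    -- Step 3: the variable letters of `w₂` are the `(S + g)`-letters of `w`.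
    have hc₂ : w₂.countP (fun l => l.2.2.2.isSome) =
        w.countP (fun l => l.2.2.2.any (fun v => decide ((v.1 - g.1, v.2 - g.2) ∈ S))) := by
      show (w₁.map _).countP _ = _
      rw [subst_countP p x w₁]
      show (w.map _).countP _ = _
      rw [countP_map_rename]
      congr 1
    rw [hc₂] at hcount
    exact hcount
  -- Step 4: sum over the translates.
  have hsumNat := stub_patternCount n S w
  have hle : w.countP (fun l => l.2.2.2.isSome) ≤ L := (List.countP_le_length).trans hlen
  have h1 : ∑ g : Fin n × Fin n, (S.card : ℝ) * (n : ℝ) ^ (2 + ε) <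
      ∑ g : Fin n × Fin n,
        (w.countP (fun l => l.2.2.2.any (fun v => decide ((v.1 - g.1, v.2 - g.2) ∈ S))) : ℝ) := by
    apply Finset.sum_lt_sum_of_nonempty Finset.univ_nonempty
    intro g _
    exact hblock g
  have h2 : (∑ g : Fin n × Fin n,
        (w.countP (fun l => l.2.2.2.any (fun v => decide ((v.1 - g.1, v.2 - g.2) ∈ S))) : ℝ)) =
      (S.card : ℝ) * (w.countP (fun l => l.2.2.2.isSome) : ℝ) := by
    exact_mod_cast hsumNat
  rw [Finset.sum_const, Finset.card_univ, Fintype.card_prod, Fintype.card_fin, nsmul_eq_mul, h2] at h1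
  have h3 : (S.card : ℝ) * (w.countP (fun l => l.2.2.2.isSome) : ℝ) ≤ (S.card : ℝ) * (L : ℝ) := by
    have : (w.countP (fun l => l.2.2.2.isSome) : ℝ) ≤ (L : ℝ) := by exact_mod_cast hle
    exact mul_le_mul_of_nonneg_left this (by positivity)
  have hSR : (0 : ℝ) < (S.card : ℝ) := by exact_mod_cast hS
  have hnR : (0 : ℝ) < (n : ℝ) := by exact_mod_cast hn0
  have h4 : ((n * n : ℕ) : ℝ) * (n : ℝ) ^ (2 + ε) < (L : ℝ) := by
    have h5 : ((n * n : ℕ) : ℝ) * ((S.card : ℝ) * (n : ℝ) ^ (2 + ε)) < (S.card : ℝ) * (L : ℝ) :=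
      h1.trans_le h3
    have h6 : (S.card : ℝ) * (((n * n : ℕ) : ℝ) * (n : ℝ) ^ (2 + ε)) < (S.card : ℝ) * (L : ℝ) := by
      linarith [h5]
    exact lt_of_mul_lt_mul_left h6 hSR.le
  have h7 : (n : ℝ) ^ (4 + ε) = ((n * n : ℕ) : ℝ) * (n : ℝ) ^ (2 + ε) := by
    rw [show (4 + ε) = 2 + (2 + ε) by ring, Real.rpow_add hnR, Real.rpow_two]
    push_cast
    ring
  rw [h7]
  exact h4.le

/-- **Pattern chain hardness (S1b') ⇒ `WordPerSuperQuartic`**, with the same `ε`: the chain normal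
form turns S1b' into its word form (`patternBlockHardness_of_patternChainHardness`), and the word form
gives the crux (`wordPerSuperQuartic_of_patternBlockHardness`). [folklore] -/
theorem wordPerSuperQuartic_of_patternChainHardness :
    (∃ ε : ℝ, 0 < ε ∧ ∃ n₀ : ℕ, ∀ n ≥ n₀, ∃ S : Finset (Fin n × Fin n), 0 < S.card ∧
      ∃ x : Fin n × Fin n → ℂ, ∀ L : List ((Fin n × Fin n) × Matrix (Fin 3) (Fin 3) ℂ),
        (∀ e ∈ L, e.1 ∈ S) →
        (∀ e ∈ L, e.2 * e.2 = 0) →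
        (L.map (fun e => (1 : Matrix (Fin 3) (Fin 3) (MvPolynomial (Fin n × Fin n) ℂ)) +
            (MvPolynomial.X e.1 : MvPolynomial (Fin n × Fin n) ℂ) •
              e.2.map (MvPolynomial.C : ℂ → MvPolynomial (Fin n × Fin n) ℂ))).prod =
          Matrix.transvection (0 : Fin 3) 2
            (MvPolynomial.aeval (fun v : Fin n × Fin n =>
                if v ∈ S then MvPolynomial.X v else MvPolynomial.C (x v)) (perPoly (Fin n) ℂ) -
              MvPolynomial.C (MvPolynomial.constantCoeff (MvPolynomial.aeval (fun v : Fin n × Fin n =>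
                if v ∈ S then MvPolynomial.X v else MvPolynomial.C (x v)) (perPoly (Fin n) ℂ)))) →
        (S.card : ℝ) * (n : ℝ) ^ (2 + ε) < (L.length : ℝ)) →
    Summit.ValiantsHypothesis.ValiantsHypothesis.Theses.ElementaryWordLength.WordPerSuperQuartic :=
  fun hP => wordPerSuperQuartic_of_patternBlockHardness (patternBlockHardness_of_patternChainHardness hP)

/-! ## The cycle-3/4 stub S1b implies S1b' — the reshape is a weakening -/

/-- The former stub S1b (`stub_chainHardness`, diagonal-transversal block, threshold `2b·n^(2+ε)`)
implies the reshaped S1b' (`stub_patternChainHardness`): take `S` = the diagonal block. -/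
theorem patternChainHardness_of_chainHardness
    (h : ∃ ε : ℝ, 0 < ε ∧ ∃ n₀ : ℕ, ∀ n ≥ n₀, ∃ b : ℕ, 0 < b ∧ 2 * b ≤ n ∧
      ∃ x : Fin n × Fin n → ℂ, ∀ L : List ((Fin n × Fin n) × Matrix (Fin 3) (Fin 3) ℂ),
        (∀ e ∈ L, e.1.1 = e.1.2 ∧ (e.1.1 : ℕ) < b) →
        (∀ e ∈ L, e.2 * e.2 = 0) →
        (L.map (fun e => (1 : Matrix (Fin 3) (Fin 3) (MvPolynomial (Fin n × Fin n) ℂ)) +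
            (X e.1 : MvPolynomial (Fin n × Fin n) ℂ) •
              e.2.map (C : ℂ → MvPolynomial (Fin n × Fin n) ℂ))).prod =
          Matrix.transvection (0 : Fin 3) 2
            (aeval (fun v : Fin n × Fin n =>
                if v.1 = v.2 ∧ (v.1 : ℕ) < b then X v else C (x v)) (perPoly (Fin n) ℂ) -
              C (constantCoeff (aeval (fun v : Fin n × Fin n =>
                if v.1 = v.2 ∧ (v.1 : ℕ) < b then X v else C (x v)) (perPoly (Fin n) ℂ)))) →
        2 * (b : ℝ) * (n : ℝ) ^ (2 + ε) < (L.length : ℝ)) :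
    ∃ ε : ℝ, 0 < ε ∧ ∃ n₀ : ℕ, ∀ n ≥ n₀, ∃ S : Finset (Fin n × Fin n), 0 < S.card ∧
      ∃ x : Fin n × Fin n → ℂ, ∀ L : List ((Fin n × Fin n) × Matrix (Fin 3) (Fin 3) ℂ),
        (∀ e ∈ L, e.1 ∈ S) →
        (∀ e ∈ L, e.2 * e.2 = 0) →
        (L.map (fun e => (1 : Matrix (Fin 3) (Fin 3) (MvPolynomial (Fin n × Fin n) ℂ)) +
            (MvPolynomial.X e.1 : MvPolynomial (Fin n × Fin n) ℂ) •
              e.2.map (MvPolynomial.C : ℂ → MvPolynomial (Fin n × Fin n) ℂ))).prod =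
          Matrix.transvection (0 : Fin 3) 2
            (MvPolynomial.aeval (fun v : Fin n × Fin n =>
                if v ∈ S then MvPolynomial.X v else MvPolynomial.C (x v)) (perPoly (Fin n) ℂ) -
              MvPolynomial.C (MvPolynomial.constantCoeff (MvPolynomial.aeval (fun v : Fin n × Fin n =>
                if v ∈ S then MvPolynomial.X v else MvPolynomial.C (x v)) (perPoly (Fin n) ℂ)))) →
        (S.card : ℝ) * (n : ℝ) ^ (2 + ε) < (L.length : ℝ) := by
  obtain ⟨ε, hε, n₀, h⟩ := h
  refine ⟨ε, hε, n₀, fun n hn => ?_⟩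
  obtain ⟨b, hb, h2b, x, hx⟩ := h n hn
  let S : Finset (Fin n × Fin n) :=
    Finset.univ.filter (fun v => v.1 = v.2 ∧ (v.1 : ℕ) < b)
  have hmem : ∀ v : Fin n × Fin n, v ∈ S ↔ (v.1 = v.2 ∧ (v.1 : ℕ) < b) := by
    intro v; simp [S]
  have hn0 : 0 < n := by omega
  have hSpos : 0 < S.card := by
    apply Finset.card_pos.2
    exact ⟨(⟨0, hn0⟩, ⟨0, hn0⟩), (hmem _).2 ⟨rfl, hb⟩⟩
  have hScard : S.card ≤ b := by
    have hsub : S ⊆ (Finset.univ : Finset (Fin b)).image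
        (fun i => ((Fin.castLE (by omega) i : Fin n), (Fin.castLE (by omega) i : Fin n))) := by
      intro v hv
      obtain ⟨h1, h2⟩ := (hmem v).1 hv
      refine Finset.mem_image.2 ⟨⟨v.1, h2⟩, Finset.mem_univ _, ?_⟩
      obtain ⟨v1, v2⟩ := v
      simp only at h1
      subst h1
      rfl
    calc S.card ≤ _ := Finset.card_le_card hsub
      _ ≤ (Finset.univ : Finset (Fin b)).card := Finset.card_image_le
      _ = b := by simp
  refine ⟨S, hSpos, x, fun L hS hN hprod => ?_⟩
  have hfun : (fun v : Fin n × Fin n =>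
      if v ∈ S then (MvPolynomial.X v : MvPolynomial (Fin n × Fin n) ℂ) else MvPolynomial.C (x v)) =
      (fun v : Fin n × Fin n => if v.1 = v.2 ∧ (v.1 : ℕ) < b then X v else C (x v)) := by
    funext v
    by_cases hv : v.1 = v.2 ∧ (v.1 : ℕ) < b
    · rw [if_pos hv, if_pos ((hmem v).2 hv)]
    · rw [if_neg hv, if_neg (fun h' => hv ((hmem v).1 h'))]
  rw [hfun] at hprod
  have h := hx L (fun e he => (hmem _).1 (hS e he)) hN hprod
  have hcb : (S.card : ℝ) ≤ 2 * (b : ℝ) := by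
    have : (S.card : ℝ) ≤ (b : ℝ) := by exact_mod_cast hScard
    have hb0 : (0 : ℝ) ≤ (b : ℝ) := by positivity
    linarith
  have hpow : (0 : ℝ) ≤ (n : ℝ) ^ (2 + ε) := by positivity
  calc (S.card : ℝ) * (n : ℝ) ^ (2 + ε) ≤ 2 * (b : ℝ) * (n : ℝ) ^ (2 + ε) :=
        mul_le_mul_of_nonneg_right hcb hpow
    _ < (L.length : ℝ) := h

end Summit.ValiantsHypothesis.ValiantsHypothesis.Theorems.WordPerSuperQuartic

end
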